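import Summits.BirchSwinnertonDyer.BirchSwinnertonDyer.Theorems.KimAtThreeSemiLocalTraceDualTwistEuler
import Summits.BirchSwinnertonDyer.BirchSwinnertonDyer.Theorems.KimAtThreeSemiLocalTraceDualLocal
import Literature.NumberTheory.AdelicBaseChange.PadicTensorCompletionGaloisProofs
import Literature.NumberTheory.EllipticCurves.BSDConductorProofs
import Literature.NumberTheory.GaloisRepresentations.CyclotomicDecompositionFrobenius
import Mathlib.RingTheory.Frobenius
import Mathlib.RingTheory.Invariant.Galois
import Mathlib.Data.ZMod.QuotientRing
import Mathlib.LinearAlgebra.FreeModule.IdealQuotient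
import HarnessLib

/-!
# Route `KimAtThreeKolyvagin` (W2): the Frobenius `σ_p ∈ Gal(ℚ(ζ_m)/ℚ)` fixes every place above `p`,
# and the Euler twist `P_w` reads PER COMPLETION along `Ψ : ℚ_p ⊗ ℚ(ζ_m) ≅ ∏_{𝔓 ∣ p} ℚ(ζ_m)_𝔓`

Cell `bsd-addord`, seat `bsd-addord-w2-acc3` (PROGRAMME PART 1b row (3), gen 6); eighth file of the
trace-duality set; `--supports stmt-BirchSwinnertonDyer-19679` (helper).  TOOL theorems only (no definition,
no named fact, no instance, no `sorry`); pure number theory / algebra of `ℚ(ζ_m)`; nothing about any curve.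

WHY.  The semi-local twisted duals (`KimAtThreeSemiLocalTraceDualTwist{,Euler,Scalar}`) are stated on
`ℚ_p ⊗_ℚ ℚ(ζ_m)` with the group-ring twist `P_w = p − a·δ_w + δ_{w²}`, `w·[p] = 1`; the per-factor packages
of crux 19560 (`hKloc` / `hKdef₀` / `hLog`, seats kim3 · acc4 · acc5 · kport) and seat w2-c4 gen 9's
LATTICE LEMMA speak PER COMPLETION `L_𝔓 = ℚ(ζ_m)_𝔓`, with the arithmetic Frobenius `φ ∈ Gal(L_𝔓/ℚ_v)`.
The bridge is: (i) `σ_{[p]}` (hence `σ_w`, `w = [p]⁻¹`) lies in the decomposition group of EVERY `𝔓 ∣ p`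
(`p ∤ m`), so it acts on each `L_𝔓` by the transport `(σ_w)_𝔓` of
`Literature.NumberTheory.Automorphic.GaloisActionPlaces`; (ii) seat w2-acc4's `Ψ` intertwines `1 ⊗ σ`
with that transport (`padicTensor_map_galois`), so `Ψ(P_w·v)_𝔓 = p·x − a·(σ_w)_𝔓 x + (σ_w)_𝔓² x`,
`x = Ψ(v)_𝔓`: the semi-local twist IS the local Euler operator `p·E_p(φ⁻¹)` factor by factor.

* §1 `isInvariant_int_ringOfIntegers` (`(𝓞_L)^{Gal} = ℤ`), `natCast_mem_asIdeal_extension`,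
  `natCard_int_quot_under_eq` (`ℤ ∩ 𝔓 = (p)`), ★ `sigma_smul_eq_self_of_coe_eq` — **`σ_u • 𝔓 = 𝔓` for
  `u ≡ p (mod m)` and every `𝔓 ∣ p`** (Mathlib's `IsArithFrobAt`: a Frobenius at `𝔓` exists in
  `Gal(ℚ(ζ_m)/ℚ)`, raises `ζ_m` to `ζ_m^p` (`p ∤ m`), hence IS `σ_{[p]}`, and stabilises `𝔓`);
  `sigma_smul_eq_self_of_mul_coe_eq_one` (`w·[p] = 1`), `sigma_pow_smul_eq_self_of_coe_eq`.
* §2 `padicTensor_tensorSigma_apply_self` (`Ψ((1 ⊗ σ_g)v)_𝔓 = (σ_g)_𝔓(Ψ(v)_𝔓)` when `σ_g • 𝔓 = 𝔓`),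
  ★ `padicTensor_eulerTwist_apply` — `Ψ(P_w·v)_𝔓 = p·x − a·S x + S(S x)`, `S := (σ_w)_𝔓`, `x = Ψ(v)_𝔓`.
* §3 `mem_cycIntLattice_iff_forall_padicTensor_mem` (`L_int = Ψ⁻¹(∏ 𝒪_𝔓)`, `p ∤ m`), ★★
  `eulerTwist_mem_cycIntLattice_iff_forall` — `P_w·v ∈ L_int ↔ ∀ 𝔓, p·x_𝔓 − a·S x_𝔓 + S²x_𝔓 ∈ 𝒪_𝔓`
  (`p ∤ m`, `w·[p] = 1`).  Per-completion twisted duals follow from these with gen 5's `𝒪_𝔓^∨ = 𝒪_𝔓`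
  (`KimAtThreeSemiLocalTraceDualLocal`) and the semi-local ★★★ of the companion files.

HONEST LIMITS: `p ∤ m` throughout §1–§3 (at `p ∣ m` the Frobenius is not defined); nothing here identifies
`(σ_{[p]})_𝔓` with a NAMED Frobenius of the local field `L_𝔓/ℚ_v` beyond the congruence `σ x ≡ x^p (mod 𝔓)`
on `𝓞_L` that defines it.

References: [CasselsFrohlichANT1967] Ch. VII §1.1 (action of `G` on primes and completions), Ch. II §10;
J. Neukirch, *Algebraic Number Theory* I §8–§9 (Frobenius of an unramified prime in `ℚ(ζ_m)`:
`σ_p(ζ) = ζ^p`) [folklore]; [Kato2004Asterisque] (5.7.1); [Kim2022StructureSelmer] §3.4.1.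
-/

set_option autoImplicit false
-- the Theorems namespace of a single-conjunct summit repeats the summit name by design (D-0017)
set_option linter.dupNamespace false
-- `CyclotomicField m ℚ`'s two `ℚ`-algebra structures agree only up to unfolding (as in the sibling files)
set_option backward.isDefEq.respectTransparency false

noncomputable section

open scoped TensorProduct NumberField BigOperators Pointwise
open NumberField IsDedekindDomain
open Literature.NumberTheory.EllipticCurves Literature.NumberTheory.EllipticCurves.Kato2004.EulerSystemValues
open Literature.NumberTheory.Automorphic Literature.NumberTheory.AdelicBaseChange
open Summit.BirchSwinnertonDyer.Rank1Residual.GaloisImage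
open Summit.BirchSwinnertonDyer.BirchSwinnertonDyer.Theorems.KimAtThreePortSharedSATCore
open Summit.BirchSwinnertonDyer.BirchSwinnertonDyer.Theorems.KimAtThreeSemiLocalTraceDualTwist
open Summit.BirchSwinnertonDyer.BirchSwinnertonDyer.Theorems.KimAtThreeSemiLocalTraceDualTwistEuler

namespace Summit.BirchSwinnertonDyer.BirchSwinnertonDyer.Theorems.KimAtThreeSemiLocalTraceDualTwistLocal

variable (m : ℕ) [NeZero m] (p : ℕ) [Fact p.Prime]

/-! ### §1 The Frobenius `σ_{[p]}` stabilises every place of `ℚ(ζ_m)` above `p ∤ m` -/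

omit [NeZero m] in
/-- **`(𝓞_L)^{Gal(L/ℚ)} = ℤ` for `L = ℚ(ζ_m)`**: an algebraic integer of `ℚ(ζ_m)` fixed by every
automorphism is a rational integer (Galois theory + integral closedness of `ℤ`) — the `IsInvariant`
hypothesis of Mathlib's Frobenius-existence theorem, for Mathlib's action of `L ≃ₐ[ℚ] L` on `𝓞 L`.
[folklore] -/
theorem isInvariant_int_ringOfIntegers :
    Algebra.IsInvariant ℤ (𝓞 (CyclotomicField m ℚ)) (CyclotomicField m ℚ ≃ₐ[ℚ] CyclotomicField m ℚ) := by
  haveI : IsGalois ℚ (CyclotomicField m ℚ) := IsCyclotomicExtension.isGalois {m} ℚ (CyclotomicField m ℚ)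
  refine ⟨fun b hb => ?_⟩
  have hfix : IntermediateField.fixedField (⊤ : Subgroup (CyclotomicField m ℚ ≃ₐ[ℚ] CyclotomicField m ℚ)) =
      ⊥ := by
    rw [← IntermediateField.fixingSubgroup_bot, IsGalois.fixedField_fixingSubgroup]
  have hmem : (b : CyclotomicField m ℚ) ∈
      IntermediateField.fixedField (⊤ : Subgroup (CyclotomicField m ℚ ≃ₐ[ℚ] CyclotomicField m ℚ)) := by
    rintro ⟨g, -⟩
    exact congrArg (fun y : 𝓞 (CyclotomicField m ℚ) => (y : CyclotomicField m ℚ)) (hb g)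
  rw [hfix, IntermediateField.mem_bot] at hmem
  obtain ⟨q, hq⟩ := hmem
  have hint : IsIntegral ℤ q := by
    have h : IsIntegral ℤ (b : CyclotomicField m ℚ) := RingOfIntegers.isIntegral_coe b
    rw [← hq] at h
    exact (isIntegral_algebraMap_iff (algebraMap ℚ (CyclotomicField m ℚ)).injective).mp h
  obtain ⟨n, hn⟩ := IsIntegrallyClosed.algebraMap_eq_of_integral hint
  refine ⟨n, ?_⟩
  apply RingOfIntegers.ext
  rw [← hq, ← hn]
  simp

omit [NeZero m] in
/-- `p ∈ 𝔓` for every place `𝔓` of `ℚ(ζ_m)` above `v_p` (kim3's `three_mem_asIdeal_extension`, any `p`).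
[folklore] -/
theorem natCast_mem_asIdeal_extension
    (w : ((Rat.HeightOneSpectrum.primesEquiv (R := 𝓞 ℚ)).symm ⟨p, Fact.out⟩).Extension
      (𝓞 (CyclotomicField m ℚ))) :
    ((p : ℕ) : 𝓞 (CyclotomicField m ℚ)) ∈ w.1.asIdeal := by
  have h0 : ((p : ℕ) : 𝓞 ℚ) ∈ ((Rat.HeightOneSpectrum.primesEquiv (R := 𝓞 ℚ)).symm ⟨p, Fact.out⟩).asIdeal :=
    (natCast_mem_asIdeal_iff_eq_primesEquiv_symm _ Fact.out).mpr rfl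
  have h1 := w.2
  rw [HeightOneSpectrum.ext_iff] at h1
  rw [← h1] at h0
  change ((p : ℕ) : 𝓞 ℚ) ∈ Ideal.comap (algebraMap (𝓞 ℚ) (𝓞 (CyclotomicField m ℚ))) w.1.asIdeal at h0
  rw [Ideal.mem_comap, map_natCast] at h0
  exact h0

omit [NeZero m] in
/-- The prime of `ℤ` under a place `𝔓 ∣ p` of `ℚ(ζ_m)` is `(p)`, so its residue ring has `p` elements.
[folklore] -/
theorem natCard_int_quot_under_eq
    (w : ((Rat.HeightOneSpectrum.primesEquiv (R := 𝓞 ℚ)).symm ⟨p, Fact.out⟩).Extension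
      (𝓞 (CyclotomicField m ℚ))) :
    Nat.card (ℤ ⧸ w.1.asIdeal.under ℤ) = p := by
  have hp : (p : ℤ) ∈ w.1.asIdeal.under ℤ := by
    rw [Ideal.under_def, Ideal.mem_comap, map_natCast]
    exact natCast_mem_asIdeal_extension m p w
  have hmax : (Ideal.span {(p : ℤ)}).IsMaximal :=
    Ideal.Quotient.maximal_of_isField _
      ((Int.quotientSpanNatEquivZMod p).toMulEquiv.isField (Field.toIsField (ZMod p)))
  have hne : w.1.asIdeal.under ℤ ≠ ⊤ := (Ideal.comap_isPrime _ _).ne_top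
  have heq : w.1.asIdeal.under ℤ = Ideal.span {(p : ℤ)} :=
    (hmax.eq_of_le hne ((Ideal.span_singleton_le_iff_mem _).mpr hp)).symm
  rw [heq, Nat.card_congr (Int.quotientSpanNatEquivZMod p).toEquiv, Nat.card_zmod]

/-- ★ **The Frobenius `σ_{[p]}` stabilises every place above `p`**: for `p ∤ m`, every `𝔓 ∣ p` of `ℚ(ζ_m)`
and every `u ∈ (ℤ/m)ˣ` with `u ≡ p`, Kato's `σ_u` (`ζ ↦ ζ^p`) satisfies `σ_u • 𝔓 = 𝔓`.  Proof: by Mathlib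
(`IsArithFrobAt.exists_of_isInvariant`) some `σ ∈ Gal(ℚ(ζ_m)/ℚ)` is a Frobenius at `𝔓`
(`σ x ≡ x^p (mod 𝔓)` on `𝓞`); it sends `ζ_m ↦ ζ_m^p` (`apply_of_pow_eq_one`, `p ∤ m`), so `σ = σ_u` (an
automorphism is determined by `ζ_m`), and a Frobenius stabilises its prime (`mem_stabilizer`).
[folklore] -/
theorem sigma_smul_eq_self_of_coe_eq (hpm : ¬ p ∣ m) (u : (ZMod m)ˣ) (hu : (u : ZMod m) = (p : ZMod m))
    (w : ((Rat.HeightOneSpectrum.primesEquiv (R := 𝓞 ℚ)).symm ⟨p, Fact.out⟩).Extension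
      (𝓞 (CyclotomicField m ℚ))) :
    sigma m u • w.1 = w.1 := by
  haveI := isInvariant_int_ringOfIntegers m
  haveI : Finite (𝓞 (CyclotomicField m ℚ) ⧸ w.1.asIdeal) :=
    Ideal.finiteQuotientOfFreeOfNeBot _ w.1.ne_bot
  obtain ⟨σ, hσ⟩ := IsArithFrobAt.exists_of_isInvariant ℤ
    (CyclotomicField m ℚ ≃ₐ[ℚ] CyclotomicField m ℚ) w.1.asIdeal
  -- `σ ζ = ζ^p`
  have hζ := IsCyclotomicExtension.zeta_spec m ℚ (CyclotomicField m ℚ)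
  have hm0 : 0 < m := Nat.pos_of_ne_zero (NeZero.ne m)
  set ζ : 𝓞 (CyclotomicField m ℚ) :=
    ⟨IsCyclotomicExtension.zeta m ℚ (CyclotomicField m ℚ), hζ.isIntegral hm0⟩ with hζdef
  have hζm : ζ ^ m = 1 := by
    apply RingOfIntegers.ext
    simp [hζdef, hζ.pow_eq_one]
  have hmQ : ((m : ℕ) : 𝓞 (CyclotomicField m ℚ)) ∉ w.1.asIdeal := by
    intro hmem
    have h1 : (m : ℤ) ∈ w.1.asIdeal.under ℤ := by
      rw [Ideal.under_def, Ideal.mem_comap, map_natCast]; exact hmem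
    have hp : (p : ℤ) ∈ w.1.asIdeal.under ℤ := by
      rw [Ideal.under_def, Ideal.mem_comap, map_natCast]
      exact natCast_mem_asIdeal_extension m p w
    -- `(under ℤ) = (p)`, so `p ∣ m`
    have hmax : (Ideal.span {(p : ℤ)}).IsMaximal :=
      Ideal.Quotient.maximal_of_isField _
        ((Int.quotientSpanNatEquivZMod p).toMulEquiv.isField (Field.toIsField (ZMod p)))
    have heq : w.1.asIdeal.under ℤ = Ideal.span {(p : ℤ)} :=
      (hmax.eq_of_le (Ideal.comap_isPrime _ _).ne_top ((Ideal.span_singleton_le_iff_mem _).mpr hp)).symm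
    rw [heq, Ideal.mem_span_singleton] at h1
    exact hpm (by exact_mod_cast h1)
  have hσζ : (σ : CyclotomicField m ℚ ≃ₐ[ℚ] CyclotomicField m ℚ)
      (IsCyclotomicExtension.zeta m ℚ (CyclotomicField m ℚ)) =
      IsCyclotomicExtension.zeta m ℚ (CyclotomicField m ℚ) ^ p := by
    have h := AlgHom.IsArithFrobAt.apply_of_pow_eq_one hσ hζm hmQ
    rw [natCard_int_quot_under_eq m p w, MulSemiringAction.toAlgHom_apply] at h
    have h' := congrArg (fun y : 𝓞 (CyclotomicField m ℚ) => (y : CyclotomicField m ℚ)) h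
    simpa [hζdef, RingOfIntegers.coe_algEquiv_smul] using h'
  -- hence `σ = σ_u`
  have hσu : σ = sigma m u := by
    apply AlgEquiv.coe_toAlgHom_injective
    refine (hζ.powerBasis ℚ).algHom_ext ?_
    rw [IsPrimitiveRoot.powerBasis_gen, AlgEquiv.coe_toAlgHom, AlgEquiv.coe_toAlgHom, hσζ,
      sigma_apply_zeta, hu, ZMod.val_natCast]
    conv_lhs => rw [← Nat.mod_add_div p m, pow_add, pow_mul, hζ.pow_eq_one, one_pow, mul_one]
  rw [← hσu]
  exact HeightOneSpectrum.ext (MulAction.mem_stabilizer_iff.mp (IsArithFrobAt.mem_stabilizer hσ))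

/-- **`σ_w • 𝔓 = 𝔓` for `w·[p] = 1`** (the (ii_τ) binder `w = [p]⁻¹`, i.e. `σ_w = φ⁻¹`): the inverse of
the Frobenius also stabilises every place above `p`. [folklore] -/
theorem sigma_smul_eq_self_of_mul_coe_eq_one (hpm : ¬ p ∣ m) (w : (ZMod m)ˣ)
    (hw : (w : ZMod m) * ((p : ℕ) : ZMod m) = 1)
    (𝔓 : ((Rat.HeightOneSpectrum.primesEquiv (R := 𝓞 ℚ)).symm ⟨p, Fact.out⟩).Extension
      (𝓞 (CyclotomicField m ℚ))) :
    sigma m w • 𝔓.1 = 𝔓.1 := by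
  have hu : ((w⁻¹ : (ZMod m)ˣ) : ZMod m) = (p : ZMod m) := Units.inv_eq_of_mul_eq_one_right hw
  have h := sigma_smul_eq_self_of_coe_eq m p hpm w⁻¹ hu 𝔓
  have hinv : sigma m w⁻¹ = (sigma m w)⁻¹ := by
    unfold sigma
    rw [map_inv]
  rw [hinv] at h
  calc sigma m w • 𝔓.1 = sigma m w • ((sigma m w)⁻¹ • 𝔓.1) := by rw [h]
    _ = 𝔓.1 := smul_inv_smul _ _

/-- Every power `σ_u^n` (`u ≡ p`) — i.e. every element of the decomposition group `⟨σ_{[p]}⟩` — stabilises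
every place above `p`. [folklore] -/
theorem sigma_pow_smul_eq_self_of_coe_eq (hpm : ¬ p ∣ m) (u : (ZMod m)ˣ) (hu : (u : ZMod m) = (p : ZMod m))
    (n : ℕ)
    (𝔓 : ((Rat.HeightOneSpectrum.primesEquiv (R := 𝓞 ℚ)).symm ⟨p, Fact.out⟩).Extension
      (𝓞 (CyclotomicField m ℚ))) :
    sigma m (u ^ n) • 𝔓.1 = 𝔓.1 := by
  induction n with
  | zero =>
    have h1 : sigma m ((u : (ZMod m)ˣ) ^ 0) = 1 := by
      unfold sigma
      rw [pow_zero, map_one]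
    rw [h1, one_smul]
  | succ n ih =>
    have hmul : sigma m (u ^ (n + 1)) = sigma m (u ^ n) * sigma m u := by
      unfold sigma
      rw [pow_succ, map_mul]
    rw [hmul, mul_smul, sigma_smul_eq_self_of_coe_eq m p hpm u hu 𝔓, ih]

/-! ### §2 The Euler twist read per completion along w2-acc4's `Ψ` -/

/-- **`Ψ((1 ⊗ σ_g) v)_𝔓 = (σ_g)_𝔓 (Ψ(v)_𝔓)`** when `σ_g • 𝔓 = 𝔓`: a Galois element in the decomposition
group of `𝔓` acts on the `𝔓`-component through the transport `galAdicCompletionMap` (w2-acc4's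
`padicTensor_map_galois` at `w' = w = 𝔓`). [cite: CasselsFrohlichANT1967, Ch. II §10 Theorem (10.2) and Ch. VII §1.1] -/
theorem padicTensor_tensorSigma_apply_self
    (Ψ : ℚ_[p] ⊗[ℚ] CyclotomicField m ℚ →ₐ[ℚ]
      (Π 𝔓 : ((Rat.HeightOneSpectrum.primesEquiv (R := 𝓞 ℚ)).symm ⟨p, Fact.out⟩).Extension
        (𝓞 (CyclotomicField m ℚ)), 𝔓.1.adicCompletion (CyclotomicField m ℚ)))
    (hΨ : ∀ (s : ℚ_[p]) (x : CyclotomicField m ℚ)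
      (𝔓 : ((Rat.HeightOneSpectrum.primesEquiv (R := 𝓞 ℚ)).symm ⟨p, Fact.out⟩).Extension
        (𝓞 (CyclotomicField m ℚ))),
      Ψ (s ⊗ₜ[ℚ] x) 𝔓 = algebraMap (CyclotomicField m ℚ) (𝔓.1.adicCompletion (CyclotomicField m ℚ)) x *
        algebraMap (((Rat.HeightOneSpectrum.primesEquiv (R := 𝓞 ℚ)).symm ⟨p, Fact.out⟩).adicCompletion ℚ)
          (𝔓.1.adicCompletion (CyclotomicField m ℚ)) (Padic.adicCompletionEquiv (𝓞 ℚ) ⟨p, Fact.out⟩ s))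
    (g : (ZMod m)ˣ)
    (𝔓 : ((Rat.HeightOneSpectrum.primesEquiv (R := 𝓞 ℚ)).symm ⟨p, Fact.out⟩).Extension
      (𝓞 (CyclotomicField m ℚ))) (h : sigma m g • 𝔓.1 = 𝔓.1) (v : ℚ_[p] ⊗[ℚ] CyclotomicField m ℚ) :
    Ψ (Algebra.TensorProduct.map (AlgHom.id ℚ ℚ_[p])
        (sigma m g : CyclotomicField m ℚ →ₐ[ℚ] CyclotomicField m ℚ) v) 𝔓 =
      galAdicCompletionMap (sigma m g) h (Ψ v 𝔓) :=
  padicTensor_map_galois Ψ hΨ (sigma m g) 𝔓 𝔓 h v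

/-- ★ **The Euler twist, factor by factor**: with `S := (σ_w)_𝔓` (the transport of `σ_w` to `L_𝔓`, available
once `σ_w • 𝔓 = 𝔓` — §1 for `w·[p] = 1`) and `x := Ψ(v)_𝔓`,
`Ψ(P_w·v)_𝔓 = p·x − a·S x + S(S x)` — the local Euler operator `p·E_p(σ_w)` on `L_𝔓`.
[cite: CasselsFrohlichANT1967, Ch. II §10 Theorem (10.2) and Ch. VII §1.1] -/
theorem padicTensor_eulerTwist_apply
    (Ψ : ℚ_[p] ⊗[ℚ] CyclotomicField m ℚ →ₐ[ℚ]
      (Π 𝔓 : ((Rat.HeightOneSpectrum.primesEquiv (R := 𝓞 ℚ)).symm ⟨p, Fact.out⟩).Extension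
        (𝓞 (CyclotomicField m ℚ)), 𝔓.1.adicCompletion (CyclotomicField m ℚ)))
    (hΨ : ∀ (s : ℚ_[p]) (x : CyclotomicField m ℚ)
      (𝔓 : ((Rat.HeightOneSpectrum.primesEquiv (R := 𝓞 ℚ)).symm ⟨p, Fact.out⟩).Extension
        (𝓞 (CyclotomicField m ℚ))),
      Ψ (s ⊗ₜ[ℚ] x) 𝔓 = algebraMap (CyclotomicField m ℚ) (𝔓.1.adicCompletion (CyclotomicField m ℚ)) x *
        algebraMap (((Rat.HeightOneSpectrum.primesEquiv (R := 𝓞 ℚ)).symm ⟨p, Fact.out⟩).adicCompletion ℚ)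
          (𝔓.1.adicCompletion (CyclotomicField m ℚ)) (Padic.adicCompletionEquiv (𝓞 ℚ) ⟨p, Fact.out⟩ s))
    (w : (ZMod m)ˣ) (a : ℤ)
    (𝔓 : ((Rat.HeightOneSpectrum.primesEquiv (R := 𝓞 ℚ)).symm ⟨p, Fact.out⟩).Extension
      (𝓞 (CyclotomicField m ℚ))) (h : sigma m w • 𝔓.1 = 𝔓.1) (v : ℚ_[p] ⊗[ℚ] CyclotomicField m ℚ) :
    Ψ (∑ g : (ZMod m)ˣ, (((((p : ℕ) : MonoidAlgebra ℤ_[p] (ZMod m)ˣ) -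
        MonoidAlgebra.single w (a : ℤ_[p]) + MonoidAlgebra.single (w ^ 2) (1 : ℤ_[p])).coeff g :
          ℤ_[p]) : ℚ_[p]) • Algebra.TensorProduct.map (AlgHom.id ℚ ℚ_[p])
            (sigma m g : CyclotomicField m ℚ →ₐ[ℚ] CyclotomicField m ℚ) v) 𝔓 =
      (p : 𝔓.1.adicCompletion (CyclotomicField m ℚ)) * Ψ v 𝔓 -
        (a : 𝔓.1.adicCompletion (CyclotomicField m ℚ)) * galAdicCompletionMap (sigma m w) h (Ψ v 𝔓) +
        galAdicCompletionMap (sigma m w) h (galAdicCompletionMap (sigma m w) h (Ψ v 𝔓)) := by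
  rw [eulerTwist_apply, map_add, map_sub, Pi.add_apply, Pi.sub_apply, padicTensor_map_smul Ψ hΨ,
    padicTensor_map_smul Ψ hΨ, padicTensor_tensorSigma_apply_self m p Ψ hΨ w 𝔓 h,
    padicTensor_tensorSigma_apply_self m p Ψ hΨ w 𝔓 h, padicTensor_tensorSigma_apply_self m p Ψ hΨ w 𝔓 h,
    map_natCast, map_natCast, map_intCast, map_intCast]

/-! ### §3 Membership in the twisted lattice, factor by factor (`p ∤ m`) -/

/-- `L_int = Ψ⁻¹(∏_𝔓 𝒪_𝔓)` (`p ∤ m`): `v ∈ cycIntLattice p m` iff every component `Ψ(v)_𝔓` is a local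
integer — w2-acc4's INTO / ONTO for `L_int′` (`padicTensor_mem_adicCompletionIntegers_of_mem_span`,
`exists_mem_span_padicTensor_eq`) and gen 5's `cycIntLattice = L_int′`. [cite: CasselsFrohlichANT1967, Ch. II §10 Theorem (10.2)] -/
theorem mem_cycIntLattice_iff_forall_padicTensor_mem (hpm : ¬ p ∣ m)
    (Ψ : ℚ_[p] ⊗[ℚ] CyclotomicField m ℚ ≃ₐ[ℚ]
      (Π 𝔓 : ((Rat.HeightOneSpectrum.primesEquiv (R := 𝓞 ℚ)).symm ⟨p, Fact.out⟩).Extension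
        (𝓞 (CyclotomicField m ℚ)), 𝔓.1.adicCompletion (CyclotomicField m ℚ)))
    (hΨ : ∀ (s : ℚ_[p]) (x : CyclotomicField m ℚ)
      (𝔓 : ((Rat.HeightOneSpectrum.primesEquiv (R := 𝓞 ℚ)).symm ⟨p, Fact.out⟩).Extension
        (𝓞 (CyclotomicField m ℚ))),
      Ψ (s ⊗ₜ[ℚ] x) 𝔓 = algebraMap (CyclotomicField m ℚ) (𝔓.1.adicCompletion (CyclotomicField m ℚ)) x *
        algebraMap (((Rat.HeightOneSpectrum.primesEquiv (R := 𝓞 ℚ)).symm ⟨p, Fact.out⟩).adicCompletion ℚ)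
          (𝔓.1.adicCompletion (CyclotomicField m ℚ)) (Padic.adicCompletionEquiv (𝓞 ℚ) ⟨p, Fact.out⟩ s))
    (v : ℚ_[p] ⊗[ℚ] CyclotomicField m ℚ) :
    v ∈ cycIntLattice p m ↔ ∀ 𝔓, Ψ v 𝔓 ∈ 𝔓.1.adicCompletionIntegers (CyclotomicField m ℚ) := by
  constructor
  · intro hv 𝔓
    have h := padicTensor_mem_adicCompletionIntegers_of_mem_span
      (Ψ : ℚ_[p] ⊗[ℚ] CyclotomicField m ℚ →ₐ[ℚ] _) hΨ
      (KimAtThreeFineKatoSemiLocalLattice.cycIntLattice_le_span_ringOfIntegers p m hv) 𝔓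
    exact h
  · intro hv
    obtain ⟨t, ht, hty⟩ := exists_mem_span_padicTensor_eq (Ψ : ℚ_[p] ⊗[ℚ] CyclotomicField m ℚ →ₐ[ℚ] _) hΨ
      (fun 𝔓 => Ψ v 𝔓) hv
    have hΨt : Ψ t = Ψ v := hty
    have htv : t = v := Ψ.injective hΨt
    rw [← htv, KimAtThreeSemiLocalTraceDualCyc.cycIntLattice_eq_span_ringOfIntegers m p hpm]
    exact ht

/-- ★★ **`P_w·v ∈ L_int` factor by factor** (`p ∤ m`, `w·[p] = 1`): `P_w·v ∈ cycIntLattice p m` iff for every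
`𝔓 ∣ p`, `p·x − a·(σ_w)_𝔓 x + (σ_w)_𝔓² x ∈ 𝒪_𝔓` with `x = Ψ(v)_𝔓` — so the semi-local preimage lattice
`P_w⁻¹L_int` of `KimAtThreeSemiLocalTraceDualTwistEuler` is `Ψ⁻¹(∏_𝔓 (p·E_p(φ⁻¹))⁻¹𝒪_𝔓)`, the product of the
local Euler-factor lattices of seat w2-c4's lattice lemma.
[cite: Kim2022StructureSelmer, §3.4.1 and the proof of Thm. 3.13 (arXiv v3 pp. 26–28)] -/
theorem eulerTwist_mem_cycIntLattice_iff_forall (hpm : ¬ p ∣ m)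
    (Ψ : ℚ_[p] ⊗[ℚ] CyclotomicField m ℚ ≃ₐ[ℚ]
      (Π 𝔓 : ((Rat.HeightOneSpectrum.primesEquiv (R := 𝓞 ℚ)).symm ⟨p, Fact.out⟩).Extension
        (𝓞 (CyclotomicField m ℚ)), 𝔓.1.adicCompletion (CyclotomicField m ℚ)))
    (hΨ : ∀ (s : ℚ_[p]) (x : CyclotomicField m ℚ)
      (𝔓 : ((Rat.HeightOneSpectrum.primesEquiv (R := 𝓞 ℚ)).symm ⟨p, Fact.out⟩).Extension
        (𝓞 (CyclotomicField m ℚ))),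
      Ψ (s ⊗ₜ[ℚ] x) 𝔓 = algebraMap (CyclotomicField m ℚ) (𝔓.1.adicCompletion (CyclotomicField m ℚ)) x *
        algebraMap (((Rat.HeightOneSpectrum.primesEquiv (R := 𝓞 ℚ)).symm ⟨p, Fact.out⟩).adicCompletion ℚ)
          (𝔓.1.adicCompletion (CyclotomicField m ℚ)) (Padic.adicCompletionEquiv (𝓞 ℚ) ⟨p, Fact.out⟩ s))
    (w : (ZMod m)ˣ) (hw : (w : ZMod m) * ((p : ℕ) : ZMod m) = 1) (a : ℤ)
    (v : ℚ_[p] ⊗[ℚ] CyclotomicField m ℚ) :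
    ∑ g : (ZMod m)ˣ, (((((p : ℕ) : MonoidAlgebra ℤ_[p] (ZMod m)ˣ) -
        MonoidAlgebra.single w (a : ℤ_[p]) + MonoidAlgebra.single (w ^ 2) (1 : ℤ_[p])).coeff g :
          ℤ_[p]) : ℚ_[p]) • Algebra.TensorProduct.map (AlgHom.id ℚ ℚ_[p])
            (sigma m g : CyclotomicField m ℚ →ₐ[ℚ] CyclotomicField m ℚ) v ∈ cycIntLattice p m ↔
    ∀ 𝔓 : ((Rat.HeightOneSpectrum.primesEquiv (R := 𝓞 ℚ)).symm ⟨p, Fact.out⟩).Extension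
        (𝓞 (CyclotomicField m ℚ)),
      (p : 𝔓.1.adicCompletion (CyclotomicField m ℚ)) * Ψ v 𝔓 -
        (a : 𝔓.1.adicCompletion (CyclotomicField m ℚ)) *
          galAdicCompletionMap (sigma m w) (sigma_smul_eq_self_of_mul_coe_eq_one m p hpm w hw 𝔓) (Ψ v 𝔓) +
        galAdicCompletionMap (sigma m w) (sigma_smul_eq_self_of_mul_coe_eq_one m p hpm w hw 𝔓)
          (galAdicCompletionMap (sigma m w) (sigma_smul_eq_self_of_mul_coe_eq_one m p hpm w hw 𝔓) (Ψ v 𝔓)) ∈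
        𝔓.1.adicCompletionIntegers (CyclotomicField m ℚ) := by
  rw [mem_cycIntLattice_iff_forall_padicTensor_mem m p hpm Ψ hΨ]
  refine forall_congr' fun 𝔓 => ?_
  have h := padicTensor_eulerTwist_apply m p (Ψ : ℚ_[p] ⊗[ℚ] CyclotomicField m ℚ →ₐ[ℚ] _) hΨ w a 𝔓
    (sigma_smul_eq_self_of_mul_coe_eq_one m p hpm w hw 𝔓) v
  exact Iff.of_eq (congrArg (fun z => z ∈ 𝔓.1.adicCompletionIntegers (CyclotomicField m ℚ)) h)

/-! ### §4 (appended) The decomposition group of a place above `p ∤ m` IS `⟨σ_{[p]}⟩` -/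

/-- ★★ **`D(𝔓) = ⟨σ_{[p]}⟩` (Washington Thm. 2.13) as an `iff`**: for `p ∤ m`, `𝔓 ∣ p` and `u ≡ p (mod m)`,
`γ ∈ Gal(ℚ(ζ_m)/ℚ)` fixes `𝔓` iff `γ = σ_u^i` for some `i` — `⟸` is §1
(`sigma_pow_smul_eq_self_of_coe_eq`), `⟹` is `CyclotomicField.autEquivPow_eq_pow_of_smul_eq`
(`Literature.NumberTheory.GaloisRepresentations.CyclotomicDecompositionFrobenius`: the residue-field
automorphism is a Frobenius power) read back through `sigma = autEquivPow⁻¹`.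
[cite: Washington1997, Thm. 2.13] -/
theorem smul_eq_self_iff_exists_eq_sigma_pow (hpm : ¬ p ∣ m) (u : (ZMod m)ˣ)
    (hu : (u : ZMod m) = (p : ZMod m))
    (𝔓 : ((Rat.HeightOneSpectrum.primesEquiv (R := 𝓞 ℚ)).symm ⟨p, Fact.out⟩).Extension
      (𝓞 (CyclotomicField m ℚ)))
    (γ : CyclotomicField m ℚ ≃ₐ[ℚ] CyclotomicField m ℚ) :
    γ • 𝔓.1 = 𝔓.1 ↔ ∃ i : ℕ, γ = sigma m (u ^ i) := by
  constructor
  · intro hγ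
    obtain ⟨i, hi⟩ := Literature.NumberTheory.GaloisRepresentations.CyclotomicField.autEquivPow_eq_pow_of_smul_eq
      hpm 𝔓.1 (natCast_mem_asIdeal_extension m p 𝔓) γ hγ
    refine ⟨i, ?_⟩
    have hunit : IsCyclotomicExtension.autEquivPow (CyclotomicField m ℚ)
        (Polynomial.cyclotomic.irreducible_rat (NeZero.pos m)) γ = u ^ i := by
      apply Units.ext
      rw [hi, Units.val_pow_eq_pow_val, hu]
    unfold sigma
    rw [← hunit, MulEquiv.symm_apply_apply]
  · rintro ⟨i, rfl⟩
    exact sigma_pow_smul_eq_self_of_coe_eq m p hpm u hu i 𝔓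

end Summit.BirchSwinnertonDyer.BirchSwinnertonDyer.Theorems.KimAtThreeSemiLocalTraceDualTwistLocal

end
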